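import Summits.QuantumFields.BalabanUV.Beta.TorusBoxProfile

/-!
# `Summit.QuantumFields.BalabanUV.Beta.MultiscaleHessianCutoff` — engine file 22b: a C² CUTOFF ON A COORDINATE BOX OF THE UNIT TORUS —
# `χ = Π_ν ψ(δ_ν(·, x₀))` with `ψ` the MOLLIFIED CLAMP (the average of `s` shifted piecewise-linear clamps): `0 ≤ χ ≤ 1`, `χ = 1` on
# `dist(·, x₀) ≤ ρ₁`, `χ = 0` off `dist(·, x₀) ≤ ρ₁ + 2s + 1`, FIRST differences `≤ 1/s` and SECOND differences `≤ 2/s²` along every axis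
# — the localiser of the pure second-order ℓ² members (3.46)₄,₆ at MODEL level (programme «HESSIAN-L2-FLAT», with files 22a, 22c–22f)

HONEST FRAMING (page 1 of everything in this cell).  Discharging `FlowStep.BetaPertH` would make Bałaban's ultraviolet
stability UNCONDITIONAL — a constructive-QFT result; it is NOT the continuum limit and NOT the Clay problem.  This module
discharges nothing of `BetaPertH`; it is [folklore] lattice calculus, kernel-checked, by the OWNER of binder row D4 (unit
`b2b-balaban-beta-an4`, gen 47).  HONEST DEPENDENCY: continuum YM on T⁴ ⇐ BetaPertH ∧ nine spine estimates (0/9 proved); BetaPertH ⇐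
(D1) ∧ (D4) ∧ CAP+tail; G-an2-4 gates asym, D1 and NE2/3/4.

THE POINT.  Census E-an4-141e: the pure second-order members need a C² cutoff (the piecewise-linear `DeGiorgiStep.cut` is one power
short).  No calculus: the lattice MOLLIFICATION `ψ(b) = s⁻¹·Σ_{j<s} η(b + j)` of the `1/s`-Lipschitz clamp `η(b) = min(1, max(0, (c − b)/s))`
has `ψ(b+1) − ψ(b) = s⁻¹(η(b+s) − η(b))`, so `|δψ| ≤ 1/s`, `|δδψ| ≤ 2/s²`, `ψ = 1` on `b ≤ c − 2s + 1`, `ψ = 0` on `b ≥ c`.  On the torus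
`χ = Π_ν ψ(circAbs(y_ν − x₀,ν))` (`c = ρ₁ + 2s`), the factor being `1` along an axis too short for the bump (`N_ν < 2(ρ₁ + 2s + 2)`); a unit
step moves one circular coordinate distance by `≤ 1`, strictly inside the half period by exactly `±1` (`circAbs_step_pair`), and at the
two ends the profile is locally constant — so `χ` inherits `ψ`'s difference bounds (the other factors lie in `[0,1]` and do not move).

WHAT IS CERTIFIED (kernel, 0 sorry; four `def`s: `clampProfile`, `mollProfile`, `axisProfile`, `boxCutoff`): §1 the clamp and its
mollification on `ℝ` (`abs_clampProfile_sub_le`, `mollProfile_succ_sub`, `abs_mollProfile_succ_sub_le`, `abs_mollProfile_second_le`,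
`mollProfile_eq_one`, `mollProfile_eq_zero`, bounds `0 ≤ · ≤ 1`); §2 circular steps (`abs_circAbs_succ_sub_le`, `circAbs_step_pair`);
§3 the torus cutoff `boxCutoff x₀ ρ₁ s`: `boxCutoff_nonneg`, `boxCutoff_le_one`, **`boxCutoff_eq_one`** (`dist(y,x₀) ≤ ρ₁`),
**`dist_le_of_boxCutoff_ne_zero`** (`≤ ρ₁ + 2s + 1`), **`abs_boxCutoff_up_sub_le`** (`≤ 1/s`), **`abs_boxCutoff_second_le`** (`≤ 2/s²`),
and `dist_le_of_cdist_le` (the box is the intersection of the coordinate slabs).  LOCATORS (shape only; ABSOLUTE RULE — nothing printed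
is asserted): [Balaban1985BackgroundPropagators] Thm 3.1 (3.46) p. 398 (`h` with `supp h ⊂ Δ(y)`); [Balaban1984PropagatorsI] (1.121) p. 37
(smooth partitions with `|∂^α h| ≤ O(M^{−|α|})`).  Row D4: NO class change (critical-path width 0; D4 DISCHARGE NO DATE); NOT BetaPertH,
NOT continuum, NOT Clay, NOT summit progress.
-/

open scoped BigOperators
open Finset

namespace Summit.QuantumFields.BalabanUV.Beta.MultiscaleHessianCutoff

open Literature.MathematicalPhysics.QuantumFieldTheory.Balaban1983to89
open B4TorusKernel.MultiPeriod (circAbs centre circAbs_nonneg circAbs_le_abs circAbs_add_mul abs_add_mul_centre circAbs_of_centred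
  two_mul_circAbs_le)
open B4Sect5Torus (TSite tdist ccoord ccoord_cast circAbs_le_tdist)
open B5TorusCover (UT)
open B5Leibniz121 (up dn up_dn)
open Summit.QuantumFields.BalabanUV.Beta.TorusBoxProfile (circAbs_add_one_le circAbs_sub_one_le cdist_up_self cdist_dn_self
  cdist_up_ne cdist_dn_ne cdist_le_of_dist_le)

noncomputable section

/-! ## §1 The clamp and its lattice mollification (functions on `ℝ`) -/

/-- The piecewise-linear clamp `η(b) = min(1, max(0, (c − b)/s))`. [folklore] -/
def clampProfile (c s b : ℝ) : ℝ := min 1 (max 0 ((c - b) / s))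

/-- `0 ≤ η`. [folklore] -/
theorem clampProfile_nonneg (c s b : ℝ) : 0 ≤ clampProfile c s b := le_min zero_le_one (le_max_left _ _)

/-- `η ≤ 1`. [folklore] -/
theorem clampProfile_le_one (c s b : ℝ) : clampProfile c s b ≤ 1 := min_le_left _ _

/-- `η = 1` on `b ≤ c − s` (`s > 0`). [folklore] -/
theorem clampProfile_eq_one {c s b : ℝ} (hs : 0 < s) (hb : b ≤ c - s) : clampProfile c s b = 1 := by
  unfold clampProfile
  have h : 1 ≤ (c - b) / s := by rw [le_div_iff₀ hs]; linarith
  rw [max_eq_right (le_trans zero_le_one h), min_eq_left h]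

/-- `η = 0` on `c ≤ b` (`s > 0`). [folklore] -/
theorem clampProfile_eq_zero {c s b : ℝ} (hs : 0 < s) (hb : c ≤ b) : clampProfile c s b = 0 := by
  unfold clampProfile
  have h : (c - b) / s ≤ 0 := div_nonpos_of_nonpos_of_nonneg (by linarith) hs.le
  rw [max_eq_left h, min_eq_right zero_le_one]

/-- **The clamp is `1/s`-Lipschitz**: `|η(b′) − η(b)| ≤ |b′ − b|/s` (`s > 0`). [folklore] -/
theorem abs_clampProfile_sub_le {c s : ℝ} (hs : 0 < s) (b b' : ℝ) :
    |clampProfile c s b' - clampProfile c s b| ≤ |b' - b| / s := by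
  unfold clampProfile
  have h1 : |min 1 (max 0 ((c - b') / s)) - min 1 (max 0 ((c - b) / s))| ≤ |max 0 ((c - b') / s) - max 0 ((c - b) / s)| :=
    abs_min_sub_min_le_max _ _ _ _ |>.trans (by rw [sub_self, abs_zero, max_eq_right (abs_nonneg _)])
  have h2 : |max 0 ((c - b') / s) - max 0 ((c - b) / s)| ≤ |(c - b') / s - (c - b) / s| :=
    abs_max_sub_max_le_max _ _ _ _ |>.trans (by rw [sub_self, abs_zero, max_eq_right (abs_nonneg _)])
  have h3 : |(c - b') / s - (c - b) / s| = |b' - b| / s := by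
    rw [← sub_div, abs_div, abs_of_pos hs, show c - b' - (c - b) = -(b' - b) by ring, abs_neg]
  linarith [h3.le, h3.ge]

/-- The MOLLIFIED clamp `ψ(b) = s⁻¹·Σ_{j<s} η(b + j)`. [folklore] -/
def mollProfile (c : ℝ) (s : ℕ) (b : ℝ) : ℝ := ((s : ℝ))⁻¹ * ∑ j ∈ range s, clampProfile c s (b + j)

/-- `0 ≤ ψ`. [folklore] -/
theorem mollProfile_nonneg (c : ℝ) (s : ℕ) (b : ℝ) : 0 ≤ mollProfile c s b :=
  mul_nonneg (inv_nonneg.mpr (Nat.cast_nonneg _)) (Finset.sum_nonneg fun _ _ => clampProfile_nonneg _ _ _)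

/-- `ψ ≤ 1`. [folklore] -/
theorem mollProfile_le_one (c : ℝ) {s : ℕ} (hs : 1 ≤ s) (b : ℝ) : mollProfile c s b ≤ 1 := by
  unfold mollProfile
  have hs0 : (0 : ℝ) < s := by exact_mod_cast hs
  rw [inv_mul_le_iff₀ hs0, mul_one]
  calc ∑ j ∈ range s, clampProfile c s (b + j) ≤ ∑ _j ∈ range s, (1 : ℝ) :=
        Finset.sum_le_sum fun j _ => clampProfile_le_one _ _ _
    _ = s := by rw [Finset.sum_const, Finset.card_range, nsmul_eq_mul, mul_one]

/-- `ψ = 1` on `b ≤ c − 2s + 1` (`s ≥ 1`). [folklore] -/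
theorem mollProfile_eq_one (c : ℝ) {s : ℕ} (hs : 1 ≤ s) {b : ℝ} (hb : b ≤ c - 2 * s + 1) : mollProfile c s b = 1 := by
  unfold mollProfile
  have hs0 : (0 : ℝ) < s := by exact_mod_cast hs
  have h : ∀ j ∈ range s, clampProfile c s (b + j) = 1 := by
    intro j hj
    have hj' : (j : ℝ) ≤ s - 1 := by
      have := Finset.mem_range.mp hj
      have : (j : ℝ) + 1 ≤ s := by exact_mod_cast this
      linarith
    exact clampProfile_eq_one hs0 (by linarith)
  rw [Finset.sum_congr rfl h, Finset.sum_const, Finset.card_range, nsmul_eq_mul, mul_one, inv_mul_cancel₀ hs0.ne']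

/-- `ψ = 0` on `c ≤ b` (`s ≥ 1`). [folklore] -/
theorem mollProfile_eq_zero (c : ℝ) {s : ℕ} (hs : 1 ≤ s) {b : ℝ} (hb : c ≤ b) : mollProfile c s b = 0 := by
  unfold mollProfile
  have hs0 : (0 : ℝ) < s := by exact_mod_cast hs
  have h : ∀ j ∈ range s, clampProfile c s (b + j) = 0 := fun j _ =>
    clampProfile_eq_zero hs0 (by have : (0 : ℝ) ≤ j := Nat.cast_nonneg _; linarith)
  rw [Finset.sum_congr rfl h, Finset.sum_const_zero, mul_zero]

/-- **Telescoping**: `ψ(b+1) − ψ(b) = s⁻¹·(η(b+s) − η(b))`. [folklore] -/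
theorem mollProfile_succ_sub (c : ℝ) (s : ℕ) (b : ℝ) :
    mollProfile c s (b + 1) - mollProfile c s b = ((s : ℝ))⁻¹ * (clampProfile c s (b + s) - clampProfile c s b) := by
  unfold mollProfile
  have h : ∑ j ∈ range s, clampProfile c s (b + 1 + j) = ∑ j ∈ range s, clampProfile c s (b + j) + clampProfile c s (b + s) -
      clampProfile c s b := by
    have e1 : ∑ j ∈ range s, clampProfile c s (b + 1 + j) = ∑ j ∈ range s, clampProfile c s (b + ((j + 1 : ℕ) : ℝ)) :=
      Finset.sum_congr rfl fun j _ => by push_cast; ring_nf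
    have e2 : ∑ j ∈ range (s + 1), clampProfile c s (b + (j : ℝ)) =
        ∑ j ∈ range s, clampProfile c s (b + ((j + 1 : ℕ) : ℝ)) + clampProfile c s (b + ((0 : ℕ) : ℝ)) :=
      Finset.sum_range_succ' (fun j => clampProfile c s (b + (j : ℝ))) s
    have e3 : ∑ j ∈ range (s + 1), clampProfile c s (b + (j : ℝ)) =
        ∑ j ∈ range s, clampProfile c s (b + (j : ℝ)) + clampProfile c s (b + ((s : ℕ) : ℝ)) :=
      Finset.sum_range_succ (fun j => clampProfile c s (b + (j : ℝ))) s
    rw [e1]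
    have : clampProfile c s (b + ((0 : ℕ) : ℝ)) = clampProfile c s b := by rw [Nat.cast_zero, add_zero]
    rw [this] at e2
    linarith
  rw [h]
  ring

/-- **First differences of `ψ` are `≤ 1/s`.** [folklore] -/
theorem abs_mollProfile_succ_sub_le (c : ℝ) {s : ℕ} (hs : 1 ≤ s) (b : ℝ) :
    |mollProfile c s (b + 1) - mollProfile c s b| ≤ 1 / s := by
  have hs0 : (0 : ℝ) < s := by exact_mod_cast hs
  rw [mollProfile_succ_sub, abs_mul, abs_of_pos (inv_pos.mpr hs0), one_div]
  refine mul_le_of_le_one_right (inv_nonneg.mpr hs0.le) ?_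
  have h1 := clampProfile_nonneg c s (b + s); have h2 := clampProfile_le_one c s (b + s)
  have h3 := clampProfile_nonneg c s b; have h4 := clampProfile_le_one c s b
  rw [abs_le]; constructor <;> linarith

/-- **Second differences of `ψ` are `≤ 2/s²`.** [folklore] -/
theorem abs_mollProfile_second_le (c : ℝ) {s : ℕ} (hs : 1 ≤ s) (b : ℝ) :
    |mollProfile c s (b + 1) - 2 * mollProfile c s b + mollProfile c s (b - 1)| ≤ 2 / (s : ℝ) ^ 2 := by
  have hs0 : (0 : ℝ) < s := by exact_mod_cast hs
  have e : mollProfile c s (b + 1) - 2 * mollProfile c s b + mollProfile c s (b - 1) =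
      (mollProfile c s (b + 1) - mollProfile c s b) - (mollProfile c s (b - 1 + 1) - mollProfile c s (b - 1)) := by
    rw [sub_add_cancel]; ring
  rw [e, mollProfile_succ_sub, mollProfile_succ_sub, ← mul_sub]
  have e2 : clampProfile c s (b + s) - clampProfile c s b - (clampProfile c s (b - 1 + s) - clampProfile c s (b - 1)) =
      (clampProfile c s (b + s) - clampProfile c s (b - 1 + s)) - (clampProfile c s b - clampProfile c s (b - 1)) := by ring
  rw [e2, abs_mul, abs_of_pos (inv_pos.mpr hs0)]
  have h1 : |clampProfile c s (b + s) - clampProfile c s (b - 1 + s)| ≤ 1 / s := by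
    have := abs_clampProfile_sub_le (c := c) hs0 (b - 1 + s) (b + s)
    rwa [show b + s - (b - 1 + s) = 1 by ring, abs_one] at this
  have h2 : |clampProfile c s b - clampProfile c s (b - 1)| ≤ 1 / s := by
    have := abs_clampProfile_sub_le (c := c) hs0 (b - 1) b
    rwa [show b - (b - 1) = 1 by ring, abs_one] at this
  have h3 := abs_sub _ _ |>.trans (add_le_add h1 h2)
  calc ((s : ℝ))⁻¹ * |clampProfile c s (b + s) - clampProfile c s (b - 1 + s) - (clampProfile c s b - clampProfile c s (b - 1))|
      ≤ ((s : ℝ))⁻¹ * (1 / s + 1 / s) := mul_le_mul_of_nonneg_left h3 (inv_nonneg.mpr hs0.le)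
    _ = 2 / (s : ℝ) ^ 2 := by field_simp; ring

/-- First differences of `ψ` between integers at distance `≤ 1`: `|ψ(a′) − ψ(a)| ≤ 1/s` for `|a′ − a| ≤ 1`. [folklore] -/
theorem abs_mollProfile_sub_le_of_step (c : ℝ) {s : ℕ} (hs : 1 ≤ s) {a a' : ℤ} (h : |a' - a| ≤ 1) :
    |mollProfile c s (a' : ℝ) - mollProfile c s (a : ℝ)| ≤ 1 / s := by
  have hs0 : (0 : ℝ) < s := by exact_mod_cast hs
  rcases (show a' = a + 1 ∨ a' = a ∨ a' = a - 1 by rcases abs_le.mp h with ⟨h1, h2⟩; omega) with h1 | h1 | h1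
  · rw [h1, Int.cast_add, Int.cast_one]; exact abs_mollProfile_succ_sub_le c hs _
  · rw [h1, sub_self, abs_zero]; positivity
  · rw [h1, Int.cast_sub, Int.cast_one, abs_sub_comm]
    have := abs_mollProfile_succ_sub_le c hs ((a : ℝ) - 1)
    rwa [sub_add_cancel] at this

/-! ## §2 Circular steps -/

/-- A unit step changes a circular distance by at most one. [folklore] -/
theorem abs_circAbs_succ_sub_le {M : ℕ} (hM : 1 ≤ M) (t : ℤ) : |circAbs M (t + 1) - circAbs M t| ≤ 1 := by
  have h1 := circAbs_add_one_le hM t; have h2 := circAbs_sub_one_le hM (t + 1)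
  rw [add_sub_cancel_right] at h2; rw [abs_le]; constructor <;> linarith

/-- **Strictly inside the half period a unit step moves the circular distance by exactly `±1` in opposite senses**:
`circAbs t = a ≥ 1`, `2(a+1) ≤ M` ⟹ `{circAbs(t+1), circAbs(t−1)} = {a+1, a−1}`. [folklore] -/
theorem circAbs_step_pair {M : ℕ} (hM : 1 ≤ M) {t a : ℤ} (ha : circAbs M t = a) (ha1 : 1 ≤ a) (haM : 2 * (a + 1) ≤ M) :
    (circAbs M (t + 1) = a + 1 ∧ circAbs M (t - 1) = a - 1) ∨ (circAbs M (t + 1) = a - 1 ∧ circAbs M (t - 1) = a + 1) := by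
  -- the centred representative `u` of `t`, `|u| = a`
  set u : ℤ := t + M * centre M t with hu
  have hua : |u| = a := by rw [hu, abs_add_mul_centre hM, ha]
  have hper : ∀ v : ℤ, circAbs M (t + v) = circAbs M (u + v) := fun v => by
    rw [hu, show t + ↑M * centre M t + v = (t + v) + M * centre M t by ring, circAbs_add_mul]
  have hp1 : circAbs M (t + 1) = |u + 1| := by
    rw [hper 1]
    exact circAbs_of_centred hM (by have := abs_add_le u 1; rw [abs_one] at this; omega)
  have hm1 : circAbs M (t - 1) = |u - 1| := by
    rw [sub_eq_add_neg, hper (-1), ← sub_eq_add_neg]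
    exact circAbs_of_centred hM (by have := abs_sub u 1; rw [abs_one] at this; omega)
  rw [hp1, hm1]
  rcases (abs_eq (by omega : (0 : ℤ) ≤ a)).mp hua with h | h
  · exact Or.inl ⟨by rw [h, abs_of_nonneg (by omega)], by rw [h, abs_of_nonneg (by omega)]⟩
  · exact Or.inr ⟨by rw [h, abs_of_nonpos (by omega)]; ring, by rw [h, abs_of_nonpos (by omega)]; ring⟩

/-! ## §3 The cutoff on a coordinate box of the unit torus -/

variable {d : ℕ} {N : Fin d → ℕ} [∀ i, NeZero (N i)]

/-- The box `dist(·, x₀) ≤ r` is the intersection of the coordinate slabs `δ_ν(·, x₀) ≤ r`. [folklore] -/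
theorem dist_le_of_cdist_le {x x₀ : UT N} {r : ℕ}
    (h : ∀ ν, circAbs (N ν) (((UT.toSite N x ν).val : ℤ) - ((UT.toSite N x₀ ν).val : ℤ)) ≤ r) : dist x x₀ ≤ r := by
  rw [UT.dist_eq]
  unfold tdist
  have hsup : Finset.univ.sup (ccoord N (UT.toSite N x) (UT.toSite N x₀)) ≤ r := by
    refine Finset.sup_le fun ν _ => ?_
    have h1 := ccoord_cast (UT.one_le N) (UT.toSite N x) (UT.toSite N x₀) ν
    have h2 := h ν
    omega
  exact_mod_cast hsup

/-- The axis factor: the mollified clamp of the `ν`-th circular coordinate distance to `x₀` (thresholds `c = ρ₁ + 2s`, width `s`),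
or the constant `1` along an axis whose period is too short for the bump (`N_ν < 2(ρ₁ + 2s + 2)`). [folklore] -/
def axisProfile (x₀ : UT N) (ρ₁ s : ℕ) (ν : Fin d) (y : UT N) : ℝ :=
  if 2 * (ρ₁ + 2 * s + 2) ≤ N ν then
    mollProfile ((ρ₁ : ℝ) + 2 * s) s ((circAbs (N ν) (((UT.toSite N y ν).val : ℤ) - ((UT.toSite N x₀ ν).val : ℤ)) : ℤ) : ℝ)
  else 1

/-- **THE BOX CUTOFF** `χ = Π_ν (axis factor)`. [cite: Balaban1984PropagatorsI, (1.121) p.37] [folklore] -/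
def boxCutoff (x₀ : UT N) (ρ₁ s : ℕ) (y : UT N) : ℝ := ∏ ν, axisProfile x₀ ρ₁ s ν y

omit [∀ i, NeZero (N i)] in
/-- `0 ≤` axis factor. [folklore] -/
theorem axisProfile_nonneg (x₀ : UT N) (ρ₁ s : ℕ) (ν : Fin d) (y : UT N) : 0 ≤ axisProfile x₀ ρ₁ s ν y := by
  unfold axisProfile; split_ifs
  · exact mollProfile_nonneg _ _ _
  · exact zero_le_one

omit [∀ i, NeZero (N i)] in
/-- axis factor `≤ 1` (`s ≥ 1`). [folklore] -/
theorem axisProfile_le_one (x₀ : UT N) (ρ₁ : ℕ) {s : ℕ} (hs : 1 ≤ s) (ν : Fin d) (y : UT N) : axisProfile x₀ ρ₁ s ν y ≤ 1 := by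
  unfold axisProfile; split_ifs
  · exact mollProfile_le_one _ hs _
  · exact le_rfl

omit [∀ i, NeZero (N i)] in
/-- `0 ≤ χ`. [folklore] -/
theorem boxCutoff_nonneg (x₀ : UT N) (ρ₁ s : ℕ) (y : UT N) : 0 ≤ boxCutoff x₀ ρ₁ s y :=
  Finset.prod_nonneg fun ν _ => axisProfile_nonneg x₀ ρ₁ s ν y

omit [∀ i, NeZero (N i)] in
/-- `χ ≤ 1` (`s ≥ 1`). [folklore] -/
theorem boxCutoff_le_one (x₀ : UT N) (ρ₁ : ℕ) {s : ℕ} (hs : 1 ≤ s) (y : UT N) : boxCutoff x₀ ρ₁ s y ≤ 1 :=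
  Finset.prod_le_one (fun ν _ => axisProfile_nonneg x₀ ρ₁ s ν y) fun ν _ => axisProfile_le_one x₀ ρ₁ hs ν y

omit [∀ i, NeZero (N i)] in
/-- The axis factor is `1` where the `ν`-th circular coordinate distance is `≤ ρ₁ + 1` (`s ≥ 1`). [folklore] -/
theorem axisProfile_eq_one (x₀ : UT N) (ρ₁ : ℕ) {s : ℕ} (hs : 1 ≤ s) (ν : Fin d) {y : UT N}
    (hy : circAbs (N ν) (((UT.toSite N y ν).val : ℤ) - ((UT.toSite N x₀ ν).val : ℤ)) ≤ ρ₁ + 1) :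
    axisProfile x₀ ρ₁ s ν y = 1 := by
  unfold axisProfile; split_ifs
  · refine mollProfile_eq_one _ hs ?_
    have : ((circAbs (N ν) (((UT.toSite N y ν).val : ℤ) - ((UT.toSite N x₀ ν).val : ℤ)) : ℤ) : ℝ) ≤ ρ₁ + 1 := by
      exact_mod_cast hy
    linarith
  · rfl

/-- **`χ = 1` on the box `dist(y, x₀) ≤ ρ₁`** (`s ≥ 1`). [folklore] -/
theorem boxCutoff_eq_one (x₀ : UT N) (ρ₁ : ℕ) {s : ℕ} (hs : 1 ≤ s) {y : UT N} (hy : dist y x₀ ≤ ρ₁) :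
    boxCutoff x₀ ρ₁ s y = 1 :=
  Finset.prod_eq_one fun ν _ => axisProfile_eq_one x₀ ρ₁ hs ν (by have := cdist_le_of_dist_le hy ν; omega)

/-- Off the box `dist(y, x₀) ≤ ρ₁ + 2s + 1` some axis factor vanishes; contrapositively, **`χ(y) ≠ 0 ⟹ dist(y, x₀) ≤ ρ₁ + 2s + 1`**
(`s ≥ 1`). [folklore] -/
theorem dist_le_of_boxCutoff_ne_zero (x₀ : UT N) (ρ₁ : ℕ) {s : ℕ} (hs : 1 ≤ s) {y : UT N} (hy : boxCutoff x₀ ρ₁ s y ≠ 0) :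
    dist y x₀ ≤ (ρ₁ + 2 * s + 1 : ℕ) := by
  refine dist_le_of_cdist_le fun ν => ?_
  have hne : axisProfile x₀ ρ₁ s ν y ≠ 0 := fun h => hy (Finset.prod_eq_zero (Finset.mem_univ ν) h)
  unfold axisProfile at hne
  split_ifs at hne with hN
  · -- cut axis: `ψ(a) ≠ 0 ⟹ a < c = ρ₁ + 2s`
    by_contra hlt
    push Not at hlt
    refine hne (mollProfile_eq_zero _ hs ?_)
    have : ((ρ₁ + 2 * s + 1 : ℕ) : ℤ) < circAbs (N ν) (((UT.toSite N y ν).val : ℤ) - ((UT.toSite N x₀ ν).val : ℤ)) := hlt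
    have h2 : ((ρ₁ : ℝ) + 2 * s + 1) < ((circAbs (N ν) (((UT.toSite N y ν).val : ℤ) - ((UT.toSite N x₀ ν).val : ℤ)) : ℤ) : ℝ) := by
      exact_mod_cast this
    linarith
  · -- short axis: the whole circle is within `N_ν/2 ≤ ρ₁ + 2s + 1`
    push Not at hN
    have h2 := two_mul_circAbs_le (N ν) (((UT.toSite N y ν).val : ℤ) - ((UT.toSite N x₀ ν).val : ℤ))
    push_cast
    omega

/-- The product splits off the `μ`-th axis factor; the remaining product is the same at `y`, `y + e_μ`, `y − e_μ` and lies in `[0,1]`.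
[folklore] -/
theorem boxCutoff_split (x₀ : UT N) (ρ₁ : ℕ) {s : ℕ} (hs : 1 ≤ s) (μ : Fin d) (y : UT N) :
    ∃ P : ℝ, 0 ≤ P ∧ P ≤ 1 ∧
      boxCutoff x₀ ρ₁ s y = axisProfile x₀ ρ₁ s μ y * P ∧
      boxCutoff x₀ ρ₁ s (up y μ) = axisProfile x₀ ρ₁ s μ (up y μ) * P ∧
      boxCutoff x₀ ρ₁ s (dn y μ) = axisProfile x₀ ρ₁ s μ (dn y μ) * P := by
  refine ⟨∏ ν ∈ univ.erase μ, axisProfile x₀ ρ₁ s ν y,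
    Finset.prod_nonneg fun ν _ => axisProfile_nonneg x₀ ρ₁ s ν y,
    Finset.prod_le_one (fun ν _ => axisProfile_nonneg x₀ ρ₁ s ν y) fun ν _ => axisProfile_le_one x₀ ρ₁ hs ν y,
    (Finset.mul_prod_erase univ (fun ν => axisProfile x₀ ρ₁ s ν y) (mem_univ μ)).symm, ?_, ?_⟩
  · have h : ∀ ν ∈ univ.erase μ, axisProfile x₀ ρ₁ s ν (up y μ) = axisProfile x₀ ρ₁ s ν y := fun ν hν => by
      unfold axisProfile; rw [cdist_up_ne y x₀ (ne_of_mem_erase hν)]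
    rw [boxCutoff, ← Finset.mul_prod_erase univ (fun ν => axisProfile x₀ ρ₁ s ν (up y μ)) (mem_univ μ), Finset.prod_congr rfl h]
  · have h : ∀ ν ∈ univ.erase μ, axisProfile x₀ ρ₁ s ν (dn y μ) = axisProfile x₀ ρ₁ s ν y := fun ν hν => by
      unfold axisProfile; rw [cdist_dn_ne y x₀ (ne_of_mem_erase hν)]
    rw [boxCutoff, ← Finset.mul_prod_erase univ (fun ν => axisProfile x₀ ρ₁ s ν (dn y μ)) (mem_univ μ), Finset.prod_congr rfl h]

/-- The axis factor moves by at most `1/s` under a unit step along its own axis (`s ≥ 1`). [folklore] -/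
theorem abs_axisProfile_up_sub_le (x₀ : UT N) (ρ₁ : ℕ) {s : ℕ} (hs : 1 ≤ s) (μ : Fin d) (y : UT N) :
    |axisProfile x₀ ρ₁ s μ (up y μ) - axisProfile x₀ ρ₁ s μ y| ≤ 1 / s := by
  unfold axisProfile
  split_ifs
  · rw [cdist_up_self]
    exact abs_mollProfile_sub_le_of_step _ hs (abs_circAbs_succ_sub_le (UT.one_le N μ) _)
  · rw [sub_self, abs_zero]; positivity

/-- **First differences of `χ` along an axis are `≤ 1/s`** (`s ≥ 1`). [folklore] -/
theorem abs_boxCutoff_up_sub_le (x₀ : UT N) (ρ₁ : ℕ) {s : ℕ} (hs : 1 ≤ s) (μ : Fin d) (y : UT N) :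
    |boxCutoff x₀ ρ₁ s (up y μ) - boxCutoff x₀ ρ₁ s y| ≤ 1 / s := by
  obtain ⟨P, hP0, hP1, hy, hup, -⟩ := boxCutoff_split x₀ ρ₁ hs μ y
  rw [hy, hup, ← sub_mul, abs_mul, abs_of_nonneg hP0]
  calc |axisProfile x₀ ρ₁ s μ (up y μ) - axisProfile x₀ ρ₁ s μ y| * P ≤ 1 / s * 1 :=
        mul_le_mul (abs_axisProfile_up_sub_le x₀ ρ₁ hs μ y) hP1 hP0 (by positivity)
    _ = 1 / s := mul_one _

/-- First differences along `−e_μ`: `|χ(y) − χ(y − e_μ)| ≤ 1/s`. [folklore] -/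
theorem abs_boxCutoff_sub_dn_le (x₀ : UT N) (ρ₁ : ℕ) {s : ℕ} (hs : 1 ≤ s) (μ : Fin d) (y : UT N) :
    |boxCutoff x₀ ρ₁ s y - boxCutoff x₀ ρ₁ s (dn y μ)| ≤ 1 / s := by
  have h := abs_boxCutoff_up_sub_le x₀ ρ₁ hs μ (dn y μ); rwa [up_dn] at h

/-- The axis factor's second difference along its own axis is `≤ 2/s²` (`s ≥ 1`): strictly inside the half period it is `ψ`'s second
difference (`circAbs_step_pair`); at distance `0` and beyond `N_μ/2 − 1` the profile is locally constant. [folklore] -/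
theorem abs_axisProfile_second_le (x₀ : UT N) (ρ₁ : ℕ) {s : ℕ} (hs : 1 ≤ s) (μ : Fin d) (y : UT N) :
    |axisProfile x₀ ρ₁ s μ (up y μ) - 2 * axisProfile x₀ ρ₁ s μ y + axisProfile x₀ ρ₁ s μ (dn y μ)| ≤ 2 / (s : ℝ) ^ 2 := by
  unfold axisProfile
  split_ifs with hN
  · rw [cdist_up_self, cdist_dn_self]
    set t : ℤ := ((UT.toSite N y μ).val : ℤ) - ((UT.toSite N x₀ μ).val : ℤ) with ht
    set a : ℤ := circAbs (N μ) t with hadef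
    set cc : ℝ := (ρ₁ : ℝ) + 2 * s with hcc
    have hM := UT.one_le N μ
    have ha0 : 0 ≤ a := circAbs_nonneg hM t
    have hNz : (2 * (ρ₁ + 2 * s + 2) : ℕ) ≤ (N μ : ℤ) := by exact_mod_cast hN
    by_cases hzero : a = 0
    · -- at the centre: all three circular distances are `≤ 1 ≤ ρ₁ + 1`, the profile is `1`
      have h1 : circAbs (N μ) (t + 1) ≤ 1 := by have := circAbs_add_one_le hM t; omega
      have h2 : circAbs (N μ) (t - 1) ≤ 1 := by have := circAbs_sub_one_le hM t; omega
      have hρ : (0:ℝ) ≤ ρ₁ := Nat.cast_nonneg _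
      have h1' : ((circAbs (N μ) (t + 1) : ℤ) : ℝ) ≤ 1 := by exact_mod_cast h1
      have h2' : ((circAbs (N μ) (t - 1) : ℤ) : ℝ) ≤ 1 := by exact_mod_cast h2
      rw [mollProfile_eq_one _ hs (b := ((a : ℤ) : ℝ)) (by rw [hzero, hcc]; push_cast; linarith),
        mollProfile_eq_one _ hs (b := ((circAbs (N μ) (t + 1) : ℤ) : ℝ)) (by rw [hcc]; linarith),
        mollProfile_eq_one _ hs (b := ((circAbs (N μ) (t - 1) : ℤ) : ℝ)) (by rw [hcc]; linarith)]; norm_num; positivity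
    by_cases hfar : 2 * (a + 1) ≤ (N μ : ℤ)
    · -- strictly inside: the genuine second difference of `ψ`
      rcases circAbs_step_pair hM hadef.symm (by omega) hfar with ⟨h1, h2⟩ | ⟨h1, h2⟩
      · rw [h1, h2, Int.cast_add, Int.cast_sub, Int.cast_one]
        exact abs_mollProfile_second_le _ hs _
      · rw [h1, h2, Int.cast_add, Int.cast_sub, Int.cast_one]
        have := abs_mollProfile_second_le cc hs (a : ℝ)
        rwa [show mollProfile cc s (↑a + 1) - 2 * mollProfile cc s ↑a + mollProfile cc s (↑a - 1) =
          mollProfile cc s (↑a - 1) - 2 * mollProfile cc s ↑a + mollProfile cc s (↑a + 1) by ring] at this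
    · -- beyond `N_μ/2 − 1`: all three circular distances are `≥ c`, the profile is `0`
      push Not at hfar
      have hac : (ρ₁ : ℤ) + 2 * s + 2 ≤ a := by push_cast at hNz; omega
      have h1 : (ρ₁ : ℤ) + 2 * s ≤ circAbs (N μ) (t + 1) := by have := circAbs_sub_one_le hM (t + 1); rw [add_sub_cancel_right] at this; omega
      have h2 : (ρ₁ : ℤ) + 2 * s ≤ circAbs (N μ) (t - 1) := by have := circAbs_add_one_le hM (t - 1); rw [sub_add_cancel] at this; omega
      rw [mollProfile_eq_zero _ hs (b := ((a : ℤ) : ℝ)) (by rw [hcc]; exact_mod_cast (by omega : (ρ₁ : ℤ) + 2 * s ≤ a)),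
        mollProfile_eq_zero _ hs (b := ((circAbs (N μ) (t + 1) : ℤ) : ℝ)) (by rw [hcc]; exact_mod_cast h1),
        mollProfile_eq_zero _ hs (b := ((circAbs (N μ) (t - 1) : ℤ) : ℝ)) (by rw [hcc]; exact_mod_cast h2)]
      norm_num; positivity
  · norm_num; positivity

/-- **Second differences of `χ` along an axis are `≤ 2/s²`** (`s ≥ 1`). [cite: Balaban1984PropagatorsI, (1.121) p.37] [folklore] -/
theorem abs_boxCutoff_second_le (x₀ : UT N) (ρ₁ : ℕ) {s : ℕ} (hs : 1 ≤ s) (μ : Fin d) (y : UT N) :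
    |boxCutoff x₀ ρ₁ s (up y μ) - 2 * boxCutoff x₀ ρ₁ s y + boxCutoff x₀ ρ₁ s (dn y μ)| ≤ 2 / (s : ℝ) ^ 2 := by
  obtain ⟨P, hP0, hP1, hy, hup, hdn⟩ := boxCutoff_split x₀ ρ₁ hs μ y
  rw [hy, hup, hdn]
  have e : axisProfile x₀ ρ₁ s μ (up y μ) * P - 2 * (axisProfile x₀ ρ₁ s μ y * P) + axisProfile x₀ ρ₁ s μ (dn y μ) * P =
      (axisProfile x₀ ρ₁ s μ (up y μ) - 2 * axisProfile x₀ ρ₁ s μ y + axisProfile x₀ ρ₁ s μ (dn y μ)) * P := by ring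
  rw [e, abs_mul, abs_of_nonneg hP0]
  calc |axisProfile x₀ ρ₁ s μ (up y μ) - 2 * axisProfile x₀ ρ₁ s μ y + axisProfile x₀ ρ₁ s μ (dn y μ)| * P ≤ 2 / (s : ℝ) ^ 2 * 1 :=
        mul_le_mul (abs_axisProfile_second_le x₀ ρ₁ hs μ y) hP1 hP0 (by positivity)
    _ = 2 / (s : ℝ) ^ 2 := mul_one _

end

end Summit.QuantumFields.BalabanUV.Beta.MultiscaleHessianCutoff
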